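import Literature.MathematicalPhysics.KineticTheory.AdmissibleCellGeometry
import Literature.MathematicalPhysics.KineticTheory.HardSphereEulerProofs
import HarnessLib

/-!
# The cell-scale collision-rate functional of a coarse state: pair-sum form and deterministic estimates

Topic `Literature/MathematicalPhysics/KineticTheory` — companion of `CollisionWindowCompensator.lean` (hazard weight
`hazardWeight`, toroidal dilute cut `toroidalDiluteCut`, static hazard `staticHazard`) and `AdmissibleCellGeometry.lean`.
The CELL-SCALE RATE FUNCTIONAL at time label `t` of a coarse state `p` (cells of all spheres, exact velocities),

  `cellRate(t, p) = (N+1)⁻¹ Σᵢ χ(t, centre cellᵢ) g(σ³ρ̃ᵢ) dilᵢ · π Y(σ³ n_{cellᵢ}) (Σ_{j ≠ i in cellᵢ} ‖vᵢ − vⱼ‖)/((N+1) r'³)`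

— Enskog's collision frequency (Chapman–Cowling 1970 §16.2–16.4: `ν = n Y ∫ π|v − w| f dw`) read cell by cell on the
coarse state, i.e. the summand of the window sum `(σ³w/ε) WS(h*·dil, ν̂)` of the crux line `Sketch` of
`InformationPercolationEngine.CollisionRate` (stmt-AtomisticToContinuum-13481, stub `stub_mesoscaleRegularityConst`) at one
window start.  This file is velocity-free bookkeeping and deterministic estimates:

* `cellRate`, `cellPairWeight`, `cellRate_coarseConfig_zipConfig_eq` — on a zipped configuration `cellRate` is the
  weighted relative-speed pair sum `Σᵢ Σⱼ wᵢⱼ ‖vᵢ − vⱼ‖` with position-dependent weights vanishing on the diagonal;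
* `abs_cellPairWeight_le`, `sum_abs_cellPairWeight_le`, `sum_cellPairWeight_eq` — `|w| ≤ C/((N+1)² r'³)`, `Σ|w| ≤ C η̄/σ³`
  (the dilute cut bounds the occupancy of the cell of `i`), `Σ w = (N+1)⁻¹ Σᵢ coefᵢ (n_{cellᵢ} − 1/((N+1)r'³))`;
* `toroidalDiluteCutCells_eq_one_of`, `abs_coarseMollDensity_sub_one_le` — on the GOOD event (every sphere in an
  admissible cell, every admissible cell density within `Δ` of `1`) the dilute cut is `1` and the coarse mollified
  density is within `2Δ + κ_m` of `1`, `κ_m = 3/(πr⁴) · (√3/2) r'` the Riemann error of the cone mollifier.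

## References

* S. Chapman, T. G. Cowling, *The Mathematical Theory of Non-Uniform Gases*, 3rd ed. (1970), §16.2–16.4.
  [ChapmanCowling1970]

## Not here

No measure: the law of large numbers for `cellRate` under the rung-0 local Gibbs law is `StaticHazardLLN.lean`.
-/

noncomputable section

open scoped BigOperators ENNReal
open Set MeasureTheory Finset
open Literature.Analysis.FluidPDE

namespace Literature.MathematicalPhysics.KineticTheory

variable (σ : ℝ) (N : ℕ) (χ : ℝ × T3 → ℝ) (g : ℝ → ℝ) (r r' ηb t : ℝ)

/-! ## The cell-scale rate functional and its pair weights -/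

/-- The CELL-SCALE RATE FUNCTIONAL at time label `t` of a coarse state: `(N+1)⁻¹ Σᵢ h*ᵢ(t) dilᵢ ν̂ᵢ` with the hazard
weight `χ(t, centre cellᵢ) g(σ³ρ̃ᵢ)`, the toroidal dilute cut and the static hazard of `CollisionWindowCompensator`.
[cite: ChapmanCowling1970, §16.4] -/
def cellRate (p : CoarseState N) : ℝ :=
  (((N + 1 : ℕ) : ℝ))⁻¹ * ∑ i, χ (t, cellCentre r' (cellsOf p i)) * g (σ ^ 3 * coarseMollDensity N r r' (cellsOf p) i) *
    toroidalDiluteCut σ N r' ηb i p * staticHazard σ N r' p i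

/-- The coefficient of sphere `i` in the cell-scale rate functional (a function of the cells only):
`coefᵢ = χ(t, centre cellᵢ) g(σ³ρ̃ᵢ) dilᵢ · π Y(σ³ n_{cellᵢ})`. [folklore] -/
def cellCoef (c : Fin (N + 1) → (Fin 3 → ℤ)) (i : Fin (N + 1)) : ℝ :=
  χ (t, cellCentre r' (c i)) * g (σ ^ 3 * coarseMollDensity N r r' c i) * toroidalDiluteCutCells σ N r' ηb i c *
    (Real.pi * contactValue (σ ^ 3 * cellDensity N r' c (c i)))

/-- The PAIR WEIGHTS of the cell-scale rate functional: `wᵢⱼ = (N+1)⁻¹ coefᵢ /((N+1) r'³)` for `j ≠ i` in the cell of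
`i`, `0` otherwise (in particular on the diagonal). [folklore] -/
def cellPairWeight (c : Fin (N + 1) → (Fin 3 → ℤ)) (i j : Fin (N + 1)) : ℝ :=
  if j ≠ i ∧ c j = c i then (((N + 1 : ℕ) : ℝ))⁻¹ * cellCoef σ N χ g r r' ηb t c i / ((((N + 1 : ℕ) : ℝ)) * r' ^ 3) else 0

/-- The pair weights vanish on the diagonal. [folklore] -/
theorem cellPairWeight_diag (c : Fin (N + 1) → (Fin 3 → ℤ)) (i : Fin (N + 1)) :
    cellPairWeight σ N χ g r r' ηb t c i i = 0 := by
  unfold cellPairWeight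
  rw [if_neg (fun h => h.1 rfl)]

/-- **Pair-sum form**: on a zipped configuration the cell-scale rate functional of its coarse-graining is the weighted
relative-speed pair sum `Σᵢ Σⱼ wᵢⱼ ‖vᵢ − vⱼ‖` with the weights of the cell configuration of the positions. [folklore] -/
theorem cellRate_coarseConfig_zipConfig_eq (xs : Fin (N + 1) → T3) (vs : Fin (N + 1) → V3) :
    cellRate σ N χ g r r' ηb t (coarseConfig (Torus.coarseCell r') (zipConfig (xs, vs))) =
      ∑ i, ∑ j, cellPairWeight σ N χ g r r' ηb t (fun l => Torus.coarseCell r' (xs l)) i j * ‖vs i - vs j‖ := by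
  have hc : cellsOf (coarseConfig (Torus.coarseCell r') (zipConfig (xs, vs))) = fun l => Torus.coarseCell r' (xs l) := rfl
  have hv : ∀ l, ((coarseConfig (Torus.coarseCell r') (zipConfig (xs, vs))) l).2 = vs l := fun l => rfl
  unfold cellRate staticHazard toroidalDiluteCut
  simp only [hc, hv]
  rw [Finset.mul_sum]
  refine Finset.sum_congr rfl fun i _ => ?_
  unfold cellPairWeight cellCoef
  simp only [ite_mul, zero_mul]
  rw [← Finset.sum_filter]
  simp only [div_eq_mul_inv, Finset.sum_mul, Finset.mul_sum]
  exact Finset.sum_congr rfl fun j _ => by ring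

variable {σ N χ g r r' ηb t}

/-! ## Sizes of the pair weights -/

/-- The toroidal dilute cut takes the values `0` and `1` only. [folklore] -/
theorem toroidalDiluteCutCells_eq_zero_or_one (i : Fin (N + 1)) (c : Fin (N + 1) → (Fin 3 → ℤ)) :
    toroidalDiluteCutCells σ N r' ηb i c = 0 ∨ toroidalDiluteCutCells σ N r' ηb i c = 1 := by
  unfold toroidalDiluteCutCells; split_ifs <;> simp

/-- **The dilute cut bounds the density of the own cell**: `dilᵢ = 1 ⟹ σ³ n_{cellᵢ} ≤ η̄` (`0 < r'`; the own cell is at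
distance `0 < 2r'`). [folklore] -/
theorem cellDensity_le_of_toroidalDiluteCutCells_eq_one (hr' : 0 < r') {i : Fin (N + 1)} {c : Fin (N + 1) → (Fin 3 → ℤ)}
    (h : toroidalDiluteCutCells σ N r' ηb i c = 1) : σ ^ 3 * cellDensity N r' c (c i) ≤ ηb := by
  unfold toroidalDiluteCutCells at h
  split_ifs at h with hall
  · exact hall (c i) (by rw [show Torus.euclidDist (cellCentre r' (c i)) (cellCentre r' (c i)) = 0 by simp]; linarith)
  · exact absurd h (by norm_num)

/-- **Uniform bound of the coefficients**: `|coefᵢ| ≤ C_χ K_g π K_Y` when `|χ(t,·)| ≤ C_χ`, `|g| ≤ K_g` on `[0,∞)`,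
`|Y| ≤ K_Y` on `[0, η₃]`, `0 ≤ η̄ ≤ η₃`, `0 ≤ σ`, `0 < r`, `0 < r'` (where `dilᵢ = 1` the own cell has `σ³n ≤ η̄ ≤ η₃`;
where `dilᵢ = 0` the coefficient vanishes). [folklore] -/
theorem abs_cellCoef_le (hσ : 0 ≤ σ) (hr : 0 < r) (hr' : 0 < r') {Cχ Kg KY η₃ : ℝ} (hCχ : ∀ x, |χ (t, x)| ≤ Cχ)
    (hKg : ∀ y, 0 ≤ y → |g y| ≤ Kg) (hKY : ∀ y, 0 ≤ y → y ≤ η₃ → |contactValue y| ≤ KY) (hηb0 : 0 ≤ ηb) (hηb : ηb ≤ η₃)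
    (c : Fin (N + 1) → (Fin 3 → ℤ)) (i : Fin (N + 1)) :
    |cellCoef σ N χ g r r' ηb t c i| ≤ Cχ * Kg * (Real.pi * KY) := by
  have hCχ0 : 0 ≤ Cχ := (abs_nonneg _).trans (hCχ 0)
  have hKg0 : 0 ≤ Kg := (abs_nonneg _).trans (hKg 0 le_rfl)
  have hKY0 : 0 ≤ KY := (abs_nonneg _).trans (hKY 0 le_rfl (hηb0.trans hηb))
  unfold cellCoef
  rcases toroidalDiluteCutCells_eq_zero_or_one (σ := σ) (r' := r') (ηb := ηb) i c with h0 | h1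
  · rw [h0, mul_zero, zero_mul, abs_zero]; positivity
  · have hn : σ ^ 3 * cellDensity N r' c (c i) ≤ ηb := cellDensity_le_of_toroidalDiluteCutCells_eq_one hr' h1
    have hn0 : 0 ≤ σ ^ 3 * cellDensity N r' c (c i) := mul_nonneg (pow_nonneg hσ 3) (cellDensity_nonneg N hr'.le c (c i))
    have hρ0 : 0 ≤ σ ^ 3 * coarseMollDensity N r r' c i := mul_nonneg (pow_nonneg hσ 3) (coarseMollDensity_nonneg N hr r' c i)
    rw [h1, mul_one, abs_mul, abs_mul, abs_mul, abs_of_pos Real.pi_pos]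
    exact mul_le_mul (mul_le_mul (hCχ _) (hKg _ hρ0) (abs_nonneg _) hCχ0)
      (mul_le_mul_of_nonneg_left (hKY _ hn0 (hn.trans hηb)) Real.pi_pos.le) (by positivity) (by positivity)

/-- On `{dilᵢ = 1}` the occupancy of the cell of `i` is at most `(η̄/σ³)(N+1) r'³`; in the form needed for the weights:
`|coefᵢ| · #{j : cell_j = cellᵢ} ≤ C_χ K_g π K_Y · (η̄/σ³) (N+1) r'³` (`0 < σ`). [folklore] -/
theorem abs_cellCoef_mul_card_le (hσ : 0 < σ) (hr : 0 < r) (hr' : 0 < r') {Cχ Kg KY η₃ : ℝ} (hCχ : ∀ x, |χ (t, x)| ≤ Cχ)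
    (hKg : ∀ y, 0 ≤ y → |g y| ≤ Kg) (hKY : ∀ y, 0 ≤ y → y ≤ η₃ → |contactValue y| ≤ KY) (hηb0 : 0 ≤ ηb) (hηb : ηb ≤ η₃)
    (c : Fin (N + 1) → (Fin 3 → ℤ)) (i : Fin (N + 1)) :
    |cellCoef σ N χ g r r' ηb t c i| * ((Finset.univ.filter fun j : Fin (N + 1) => c j = c i).card : ℝ) ≤
      Cχ * Kg * (Real.pi * KY) * (ηb / σ ^ 3 * ((((N + 1 : ℕ) : ℝ)) * r' ^ 3)) := by
  have hCχ0 : 0 ≤ Cχ := (abs_nonneg _).trans (hCχ 0)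
  have hKg0 : 0 ≤ Kg := (abs_nonneg _).trans (hKg 0 le_rfl)
  have hKY0 : 0 ≤ KY := (abs_nonneg _).trans (hKY 0 le_rfl (hηb0.trans hηb))
  have hs : 0 < σ ^ 3 := pow_pos hσ 3
  rcases toroidalDiluteCutCells_eq_zero_or_one (σ := σ) (r' := r') (ηb := ηb) i c with h0 | h1
  · have : cellCoef σ N χ g r r' ηb t c i = 0 := by unfold cellCoef; rw [h0]; ring
    rw [this, abs_zero, zero_mul]; positivity
  · have hn : σ ^ 3 * cellDensity N r' c (c i) ≤ ηb := cellDensity_le_of_toroidalDiluteCutCells_eq_one hr' h1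
    have hcard : ((Finset.univ.filter fun j : Fin (N + 1) => c j = c i).card : ℝ) ≤ ηb / σ ^ 3 * ((((N + 1 : ℕ) : ℝ)) * r' ^ 3) := by
      rw [card_filter_eq_mul_cellDensity N hr'.ne' c (c i), div_mul_eq_mul_div, le_div_iff₀ hs]
      nlinarith [mul_nonneg (by positivity : (0 : ℝ) ≤ (((N + 1 : ℕ) : ℝ)) * r' ^ 3) hs.le]
    exact mul_le_mul (abs_cellCoef_le hσ.le hr hr' hCχ hKg hKY hηb0 hηb c i) hcard (Nat.cast_nonneg _) (by positivity)

/-- **Uniform bound of the pair weights**: `|wᵢⱼ| ≤ (N+1)⁻¹ C_χ K_g π K_Y /((N+1) r'³)`. [folklore] -/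
theorem abs_cellPairWeight_le (hσ : 0 ≤ σ) (hr : 0 < r) (hr' : 0 < r') {Cχ Kg KY η₃ : ℝ} (hCχ : ∀ x, |χ (t, x)| ≤ Cχ)
    (hKg : ∀ y, 0 ≤ y → |g y| ≤ Kg) (hKY : ∀ y, 0 ≤ y → y ≤ η₃ → |contactValue y| ≤ KY) (hηb0 : 0 ≤ ηb) (hηb : ηb ≤ η₃)
    (c : Fin (N + 1) → (Fin 3 → ℤ)) (i j : Fin (N + 1)) :
    |cellPairWeight σ N χ g r r' ηb t c i j| ≤ (((N + 1 : ℕ) : ℝ))⁻¹ * (Cχ * Kg * (Real.pi * KY)) / ((((N + 1 : ℕ) : ℝ)) * r' ^ 3) := by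
  have h := abs_cellCoef_le hσ hr hr' hCχ hKg hKY hηb0 hηb c i
  have h0 : 0 ≤ Cχ * Kg * (Real.pi * KY) := (abs_nonneg _).trans h
  unfold cellPairWeight
  split_ifs
  · rw [abs_div, abs_mul, abs_of_pos (by positivity : (0 : ℝ) < (((N + 1 : ℕ) : ℝ))⁻¹),
      abs_of_pos (by positivity : (0 : ℝ) < (((N + 1 : ℕ) : ℝ)) * r' ^ 3)]
    gcongr
  · rw [abs_zero]; positivity

/-- **The absolute pair weights sum to at most `C_χ K_g π K_Y · η̄/σ³`** (`0 < σ`): row `i` has `#{j ≠ i in cellᵢ}`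
nonzero entries of size `(N+1)⁻¹|coefᵢ|/((N+1)r'³)`, and `|coefᵢ| · #cellᵢ ≤ C (η̄/σ³)(N+1) r'³`. [folklore] -/
theorem sum_abs_cellPairWeight_le (hσ : 0 < σ) (hr : 0 < r) (hr' : 0 < r') {Cχ Kg KY η₃ : ℝ} (hCχ : ∀ x, |χ (t, x)| ≤ Cχ)
    (hKg : ∀ y, 0 ≤ y → |g y| ≤ Kg) (hKY : ∀ y, 0 ≤ y → y ≤ η₃ → |contactValue y| ≤ KY) (hηb0 : 0 ≤ ηb) (hηb : ηb ≤ η₃)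
    (c : Fin (N + 1) → (Fin 3 → ℤ)) :
    ∑ i, ∑ j, |cellPairWeight σ N χ g r r' ηb t c i j| ≤ Cχ * Kg * (Real.pi * KY) * (ηb / σ ^ 3) := by
  have hN : (0 : ℝ) < (((N + 1 : ℕ) : ℝ)) := by positivity
  have hrow : ∀ i, ∑ j, |cellPairWeight σ N χ g r r' ηb t c i j| ≤
      (((N + 1 : ℕ) : ℝ))⁻¹ * (Cχ * Kg * (Real.pi * KY) * (ηb / σ ^ 3)) := by
    intro i
    have hterm : ∀ j, |cellPairWeight σ N χ g r r' ηb t c i j| ≤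
        (if c j = c i then (1 : ℝ) else 0) * ((((N + 1 : ℕ) : ℝ))⁻¹ * |cellCoef σ N χ g r r' ηb t c i| / ((((N + 1 : ℕ) : ℝ)) * r' ^ 3)) := by
      intro j
      unfold cellPairWeight
      split_ifs with h1 h2 h2
      · rw [one_mul, abs_div, abs_mul, abs_of_pos (by positivity : (0 : ℝ) < (((N + 1 : ℕ) : ℝ))⁻¹),
          abs_of_pos (by positivity : (0 : ℝ) < (((N + 1 : ℕ) : ℝ)) * r' ^ 3)]
      · exact absurd h1.2 h2
      · rw [abs_zero, one_mul]; positivity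
      · rw [abs_zero, zero_mul]
    calc ∑ j, |cellPairWeight σ N χ g r r' ηb t c i j|
        ≤ ∑ j, (if c j = c i then (1 : ℝ) else 0) * ((((N + 1 : ℕ) : ℝ))⁻¹ * |cellCoef σ N χ g r r' ηb t c i| /
            ((((N + 1 : ℕ) : ℝ)) * r' ^ 3)) := Finset.sum_le_sum fun j _ => hterm j
      _ = ((Finset.univ.filter fun j : Fin (N + 1) => c j = c i).card : ℝ) * ((((N + 1 : ℕ) : ℝ))⁻¹ *
            |cellCoef σ N χ g r r' ηb t c i| / ((((N + 1 : ℕ) : ℝ)) * r' ^ 3)) := by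
          rw [← Finset.sum_mul, ← Finset.natCast_card_filter]
      _ = (((N + 1 : ℕ) : ℝ))⁻¹ * (|cellCoef σ N χ g r r' ηb t c i| *
            ((Finset.univ.filter fun j : Fin (N + 1) => c j = c i).card : ℝ)) / ((((N + 1 : ℕ) : ℝ)) * r' ^ 3) := by ring
      _ ≤ (((N + 1 : ℕ) : ℝ))⁻¹ * (Cχ * Kg * (Real.pi * KY) * (ηb / σ ^ 3 * ((((N + 1 : ℕ) : ℝ)) * r' ^ 3))) /
            ((((N + 1 : ℕ) : ℝ)) * r' ^ 3) :=
          div_le_div_of_nonneg_right (mul_le_mul_of_nonneg_left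
            (abs_cellCoef_mul_card_le hσ hr hr' hCχ hKg hKY hηb0 hηb c i) (by positivity)) (by positivity)
      _ = (((N + 1 : ℕ) : ℝ))⁻¹ * (Cχ * Kg * (Real.pi * KY) * (ηb / σ ^ 3)) := by
          have : (((N + 1 : ℕ) : ℝ)) * r' ^ 3 ≠ 0 := by positivity
          field_simp
  calc ∑ i, ∑ j, |cellPairWeight σ N χ g r r' ηb t c i j|
      ≤ ∑ _i : Fin (N + 1), (((N + 1 : ℕ) : ℝ))⁻¹ * (Cχ * Kg * (Real.pi * KY) * (ηb / σ ^ 3)) := Finset.sum_le_sum fun i _ => hrow i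
    _ = Cχ * Kg * (Real.pi * KY) * (ηb / σ ^ 3) := by
        rw [Finset.sum_const, Finset.card_univ, Fintype.card_fin, nsmul_eq_mul]
        field_simp

/-- **The total pair weight**: `Σᵢ Σⱼ wᵢⱼ = (N+1)⁻¹ Σᵢ coefᵢ · (n_{cellᵢ} − 1/((N+1) r'³))` (`r' ≠ 0`; the row sum
counts the `#cellᵢ − 1` partners of `i`). [folklore] -/
theorem sum_cellPairWeight_eq (hr' : r' ≠ 0) (c : Fin (N + 1) → (Fin 3 → ℤ)) :
    ∑ i, ∑ j, cellPairWeight σ N χ g r r' ηb t c i j =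
      (((N + 1 : ℕ) : ℝ))⁻¹ * ∑ i, cellCoef σ N χ g r r' ηb t c i *
        (cellDensity N r' c (c i) - ((((N + 1 : ℕ) : ℝ)) * r' ^ 3)⁻¹) := by
  classical
  have hN : (((N + 1 : ℕ) : ℝ)) ≠ 0 := by positivity
  rw [Finset.mul_sum]
  refine Finset.sum_congr rfl fun i _ => ?_
  have hrow : ∑ j, cellPairWeight σ N χ g r r' ηb t c i j =
      (((Finset.univ.filter fun j : Fin (N + 1) => j ≠ i ∧ c j = c i).card : ℝ)) *
        ((((N + 1 : ℕ) : ℝ))⁻¹ * cellCoef σ N χ g r r' ηb t c i / ((((N + 1 : ℕ) : ℝ)) * r' ^ 3)) := by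
    unfold cellPairWeight
    rw [← Finset.sum_filter, Finset.sum_const, nsmul_eq_mul]
  have hcard : ((Finset.univ.filter fun j : Fin (N + 1) => j ≠ i ∧ c j = c i).card : ℝ) =
      ((Finset.univ.filter fun j : Fin (N + 1) => c j = c i).card : ℝ) - 1 := by
    have h1 : (Finset.univ.filter fun j : Fin (N + 1) => j ≠ i ∧ c j = c i) =
        (Finset.univ.filter fun j : Fin (N + 1) => c j = c i).erase i := by
      ext j; simp [Finset.mem_erase]
    have hmem : i ∈ Finset.univ.filter (fun j : Fin (N + 1) => c j = c i) := Finset.mem_filter.2 ⟨Finset.mem_univ _, rfl⟩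
    have hc1 := Finset.card_erase_of_mem hmem
    rw [h1, hc1, Nat.cast_sub (Finset.card_pos.2 ⟨i, hmem⟩), Nat.cast_one]
  rw [hrow, hcard, card_filter_eq_mul_cellDensity N hr' c (c i)]
  have : (((N + 1 : ℕ) : ℝ)) * r' ^ 3 ≠ 0 := mul_ne_zero hN (pow_ne_zero 3 hr')
  field_simp

/-! ## The good event: every sphere in an admissible cell, every admissible cell density near `1` -/

/-- **On the good event the dilute cut is `1`**: if every sphere lies in an admissible cell, every admissible cell has
density `≤ 1 + Δ`, and `σ³(1 + Δ) ≤ η̄`, `0 ≤ η̄`, then `dilᵢ = 1` for every `i` (non-admissible cells are empty).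
[folklore] -/
theorem toroidalDiluteCutCells_eq_one_of {m : ℕ} {Δ : ℝ} (hσ : 0 ≤ σ) (hηb0 : 0 ≤ ηb) (hΔ : σ ^ 3 * (1 + Δ) ≤ ηb)
    {c : Fin (N + 1) → (Fin 3 → ℤ)} (hc : ∀ j, c j ∈ admissibleCells m)
    (hn : ∀ e ∈ admissibleCells m, cellDensity N r' c e ≤ 1 + Δ) (i : Fin (N + 1)) :
    toroidalDiluteCutCells σ N r' ηb i c = 1 := by
  unfold toroidalDiluteCutCells
  rw [if_pos]
  intro e _
  by_cases he : e ∈ admissibleCells m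
  · exact (mul_le_mul_of_nonneg_left (hn e he) (pow_nonneg hσ 3)).trans hΔ
  · rw [cellDensity_eq_zero_of_not_mem r' hc he, mul_zero]; exact hηb0

/-- **On the good event the coarse mollified density is near `1`**: if every sphere lies in an admissible cell and every
admissible cell density is within `Δ` of `1` (`0 ≤ Δ`), then `|ρ̃ᵢ − 1| ≤ 2Δ + κ_m`, `κ_m = 3/(πr⁴) · (√3/2) r'_m` (the
regrouped sum `Σ_e r'³ n_e b_r(e, cellᵢ)` is within `Δ · Σ_e r'³ b_r(e, cellᵢ)` of the Riemann sum of the cone mollifier,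
itself within `κ_m ≤ 1` of `1`; `0 < r < 1/2`, `1 ≤ m`). [folklore] -/
theorem abs_coarseMollDensity_sub_one_le {m : ℕ} (hm : 1 ≤ m) {r : ℝ} (hr : 0 < r) (hr2 : r < 1 / 2) {Δ : ℝ} (hΔ : 0 ≤ Δ)
    (hκ : 3 / (Real.pi * r ^ 4) * (Real.sqrt 3 / 2 * admissibleCellSize m) ≤ 1)
    {c : Fin (N + 1) → (Fin 3 → ℤ)} (hc : ∀ j, c j ∈ admissibleCells m)
    (hn : ∀ e ∈ admissibleCells m, |cellDensity N (admissibleCellSize m) c e - 1| ≤ Δ) (i : Fin (N + 1)) :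
    |coarseMollDensity N r (admissibleCellSize m) c i - 1| ≤ 2 * Δ + 3 / (Real.pi * r ^ 4) * (Real.sqrt 3 / 2 * admissibleCellSize m) := by
  set r' := admissibleCellSize m with hr'
  set κ := 3 / (Real.pi * r ^ 4) * (Real.sqrt 3 / 2 * admissibleCellSize m) with hκdef
  set R : ℝ := ∑ e ∈ admissibleCells m, r' ^ 3 * coneKernel r (cellCentre r' e) (cellCentre r' (c i)) with hR
  have hr'0 : r' ≠ 0 := (admissibleCellSize_pos hm).ne'
  have hρ : coarseMollDensity N r r' c i = ∑ e ∈ admissibleCells m, r' ^ 3 * cellDensity N r' c e *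
      coneKernel r (cellCentre r' e) (cellCentre r' (c i)) := by
    unfold coarseMollDensity
    exact inv_mul_sum_eq_sum_cellDensity_mul hr'0 hc fun e => coneKernel r (cellCentre r' e) (cellCentre r' (c i))
  have hRκ : |R - 1| ≤ κ := abs_sum_coneKernel_sub_one_le hm hr hr2 _
  have hb0 : ∀ e, 0 ≤ r' ^ 3 * coneKernel r (cellCentre r' e) (cellCentre r' (c i)) := fun e =>
    mul_nonneg (pow_nonneg (admissibleCellSize_pos hm).le 3) (coneKernel_mem_Icc hr _ _).1
  have h1 : |coarseMollDensity N r r' c i - R| ≤ Δ * R := by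
    rw [hρ, hR, ← Finset.sum_sub_distrib, Finset.mul_sum]
    refine (Finset.abs_sum_le_sum_abs _ _).trans (Finset.sum_le_sum fun e he => ?_)
    rw [show r' ^ 3 * cellDensity N r' c e * coneKernel r (cellCentre r' e) (cellCentre r' (c i)) -
      r' ^ 3 * coneKernel r (cellCentre r' e) (cellCentre r' (c i)) =
        (cellDensity N r' c e - 1) * (r' ^ 3 * coneKernel r (cellCentre r' e) (cellCentre r' (c i))) by ring, abs_mul,
      abs_of_nonneg (hb0 e)]
    exact mul_le_mul_of_nonneg_right (hn e he) (hb0 e)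
  have hR1 : R ≤ 1 + κ := by have := (abs_le.1 hRκ).2; linarith
  have hκ0 : 0 ≤ κ := by rw [hκdef]; have := admissibleCellSize_pos hm; positivity
  calc |coarseMollDensity N r r' c i - 1| ≤ |coarseMollDensity N r r' c i - R| + |R - 1| := abs_sub_le _ _ _
    _ ≤ Δ * R + κ := add_le_add h1 hRκ
    _ ≤ Δ * (1 + κ) + κ := by gcongr
    _ ≤ 2 * Δ + κ := by nlinarith

end Literature.MathematicalPhysics.KineticTheory

end
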